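import Summits.QuantumFields.YangMills.Theorems.UnitScaleTiltProp7PinnedFlatCoercivity
import HarnessLib

/-!
# Route `UnitScaleTilt`, crux K1 «MinimiserStabilityRegPr» (stmt-QuantumFields-19200), route-R E′ path (α′), door ✓`Prop7LocMinOfPinnedChartSlice` —
# THE FLAT ENGINE OF THE ζ-ROW «`DIV ≤ ζ·K` on `S_H ∩ fibre`»: for an `M_N(ℂ)`-valued bond field `Y` on the finest torus with `Q^{(k)}Y = 0` and
# `Δ(∂^*Y) = 0` off the `k`-centres, `Σ_x ‖∂^*Y(x)‖²_F ≤ C_H·(2 + 600·N²·L⁴/(√L − 1)²)·Σ_p ‖(∂Y)(p)‖²_F`, GIVEN the centre-harmonic lemma (LEMMA H) as a displayed row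

Cell `ym3-torus`, width seat `ym3-torus-px17` (gen 0; namer ★ym-ust-19200-p1 g14 «px17: ENGINE GO» 2026-08-28 17:21Z).  THEOREMS ONLY (0 `def`, 0 `sorry`);
`--supports stmt-QuantumFields-19200`, count-neutral.  YM₃ on T³ is a ladder rung (R3), not the Clay problem; nothing here claims the stub, the crux, d = 4 or the mass gap.

WHY.  The path-(α′) door ✓`Prop7LocMinOfPinnedChartSlice.stub_PV3E_of_chartSliceHess` leaves, per competitor, the row `DIV(D_H) ≤ ζ·K(D_H)` for the DIV-optimal
representative `D_H` inside the pinned group (`S_H`: `Δ_W(D^*_W D_H) = 0` off the `k`-centres).  Its FLAT LINEAR core is: `Q^{(k)}Y = 0 ∧ Δ(∂^*Y) = 0` off the centres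
`⟹ Σ‖∂^*Y‖² ≤ ζ·Σ‖∂Y‖²` with `ζ` depending on `L, N` only.  This file is the ENGINE of that implication: everything except the one Fourier estimate (LEMMA H,
★ym-routeR-w3 g5 `Prop7CentreHarmonicDivFlat.lemmaH_flat` on the `Tor (fine n M)` carrier), which enters as the displayed hypothesis `hH` in this file's own letters
(`Site P 0`, `laplace 1`, `embIter`) and is discharged by a dictionary file.  The engine is the pinned chain of ✓`Prop7PinnedFlatCoercivity` (N7) with its
tent∕Dirichlet step removed: Hodge split `Y = B + ∂φ` (✓`exists_matrixCoulombGauge`), constraint split `L^k·Q_kB(c) + (φ(c₊) − φ(c₋)) = Λ(c₊) − Λ(c₋)` with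
`‖Λ(y)‖² ≤ c₂·E_k(B)(y)` (✓`exists_constraint_on_hodge_parts_bound`), face-flux orthogonality (✓`sum_faceLayer_mul_coarseGrad_eq_zero`) and the line∕face-mean
comparison (✓`sum_sq_lineMean_sub_faceMean_le`) give `Σ_c (φ(c₊) − φ(c₋))² ≤ 2Σ_c r(c)² + 2L^k·Σ_p (∂Y)(p)²` per real component; LEMMA H turns the centre
differences of `φ` into `L^k·Σ_x (Δφ)(x)² = L^k·DIV`; `Σ_c‖Λ(c₊) − Λ(c₋)‖²_F ≤ 12N·c₂·Σ_p‖∂Y‖²_F` as in N7.  NUMERICS (px17 memo `LOCATE-SBLKDIV-FOURIER-px17.md`,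
19200 evidence): the sharp flat `ζ` of the exact (0.4) average is 0.057∕0.055∕0.109∕0.025 at `ℓ = 3∕5∕7∕9` (odd `L`), so the constant below is generous.

WHAT IS PROVED (ns `…Theorems.Prop7CentreHarmonicDivEngine`; lattice factor `1`, `d = 3`):
* §1 `map_laplace` (readings commute with `Δ`), ★ `sum_coarseDiff_sq_le` — the real core: `∂^*B = 0`, `L^k·Q_kB + δ_c λ = r` ⟹ `Σ_c (δ_cλ)² ≤ 2Σr² + 2L^k·Σ_p(∂B)²`.
* §2 ★ `component_div_bound` — one real reading `π` of the matrix Hodge parts, with LEMMA H displayed: `Σ_x (Δ(π∘φ))² ≤ C_H·(2(L^k)⁻¹Σ_c π(Λ(c₊)−Λ(c₋))² + 2Σ_p π(∂Y)²)`.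
* §3 ★★★ `sum_diverg_normSq_le_curl_normSq_of_centreHarmonic` — the flat ζ-row with LEMMA H displayed, constant `C_H·(2 + 600N²L⁴/(√L−1)²)`, uniform in `k` and in
  the volume; `…_T3` the instance on run `K` of a T³ family at comparison height `n` (`k = K − n`).
HONEST SCOPE.  Flat (`W = 1`), linear; LEMMA H displayed (`hH`), not proved here; nothing curved, nothing about the chart or the door's other rows.

References: T. Bałaban, CMP 95 (1984) 17–40 [Balaban1984PropagatorsI] ((1.21) p.21, Prop. 1.1 (1.90) p.33); CMP 102 (1985) 277–309 [Balaban1985Variational]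
(Prop. 7 p.299, (141)–(143)); CMP 99 (1985) 389–434 [Balaban1985BackgroundPropagators] ((3.118)–(3.122) pp.419–420, Thm 3.11 p.416).
-/

set_option autoImplicit false

noncomputable section

open scoped BigOperators Matrix.Norms.L2Operator Matrix

namespace Summit.QuantumFields.YangMills.Theorems.Prop7CentreHarmonicDivEngine

open Literature.MathematicalPhysics.QuantumFieldTheory.Balaban1983to89
open Finset LatticeFieldCalculus BlockAveragingEMLLinearised
open B15DeterminingSets (embIter)
open B10StarCount (sum_pbond)
open Summit.QuantumFields.YangMills.Theorems.Prop7FlatCoercivity (sum_shift sitesPerDir_zero_eq_pow_mul bondAvgIter_eq_lineBlockAvg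
  bondAvgIter_eq_lineBlockAvg_real sum_grad_sq_eq_curl_add_diverg)
open Summit.QuantumFields.YangMills.Theorems.Prop7FaceFluxLineMean (sum_faceLayer_mul_coarseGrad_eq_zero sum_sq_lineMean_sub_faceMean_le)
open Summit.QuantumFields.YangMills.Theorems.Prop7PinnedFlatCoercivity (map_grad map_diverg map_curl map_bondAvgIter exists_reEntry exists_imEntry
  sum_normSq_le_mul_opNorm_sq sum_normSq_sub_le sum_pbond_tgt_add_src sum_blockEnergy_le sum_grad_normSq_eq_curl_normSq sum_comm₃)

variable {P : Params}

/-! ## §1 The real core: centre differences of the potential against the constraint data and the curl energy -/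

section RealCore

variable {V : Type*} [AddCommGroup V] [Module ℝ V]

/-- `π ∘ Δ = Δ ∘ π` for an `ℝ`-linear reading `π` (`Δ = ∂^*∂` and `map_diverg`, `map_grad`). [folklore] -/
theorem map_laplace {j : ℕ} (π : V →ₗ[ℝ] ℝ) (φ : SiteField P j V) (x : Site P j) :
    π (laplace 1 φ x) = laplace 1 (fun y => π (φ y)) x := by
  have h1 : laplace 1 φ x = diverg 1 (grad 1 φ) x := by rw [diverg_grad]
  have h2 : laplace 1 (fun y => π (φ y)) x = diverg 1 (grad 1 (fun y => π (φ y))) x := by rw [diverg_grad]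
  rw [h1, h2, map_diverg π (grad 1 φ) x]
  congr 1
  funext e
  exact map_grad π φ e

/-- ★ **THE REAL CORE** (N7's steps (a), (c)–(f) without the tent∕Dirichlet step; `d = 3`): for a divergence-free real bond field `B`, any real site function
`λ` and coarse data `r` with `L^k·(Q_kB)(c) + (λ(embIter k c₊) − λ(embIter k c₋)) = r(c)` on every `k`-bond `c`,
`Σ_c (λ(c₊) − λ(c₋))² ≤ 2·Σ_c r(c)² + 2·L^k·Σ_p (∂B)(p)²` — the coarse gradient of `λ∘embIter` is `ℓ²`-orthogonal to the face flux of `B`, and the line mean of `B`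
differs from its face mean by longitudinal gradients only. [cite: Balaban1984PropagatorsI, Prop. 1.1 (1.90) p.33; Balaban1985Variational, Prop. 7 p.299] -/
theorem sum_coarseDiff_sq_le (hd : P.d = 3) {k : ℕ} (hk : k ≤ P.m + P.K)
    (B : VecField P 0 ℝ) (lam : SiteField P 0 ℝ) (r : PBond P k → ℝ)
    (hdiv : diverg 1 B = 0)
    (hC1 : ∀ c : PBond P k, (P.L : ℝ) ^ k * bondAvgIter k B c + (lam (embIter k c.tgt) - lam (embIter k c.src)) = r c) :
    ∑ c : PBond P k, (lam (embIter k c.tgt) - lam (embIter k c.src)) ^ 2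
      ≤ 2 * ∑ c : PBond P k, r c ^ 2 + 2 * (P.L : ℝ) ^ k * ∑ p : Plaq P 0, curl 1 B p ^ 2 := by
  classical
  have h := sitesPerDir_zero_eq_pow_mul (P := P) hk
  have hL1 : (1 : ℝ) ≤ P.L := by exact_mod_cast P.L_pos
  set ℓ : ℝ := (P.L : ℝ) ^ k with hℓ
  have hℓ1 : 1 ≤ ℓ := one_le_pow₀ hL1
  have hℓ0 : 0 < ℓ := by positivity
  -- the letters
  set M : PBond P k → ℝ := fun c => bondAvgIter k B c with hM
  set FS : PBond P k → ℝ := fun c =>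
    ∑ x ∈ univ.filter (fun x : Site P 0 => Site.proj k k x = c.src ∧ (x c.dir).val % P.L ^ k + 1 = P.L ^ k), B ⟨x, c.dir⟩ with hFS
  set D : PBond P k → ℝ := fun c => lam (embIter k c.tgt) - lam (embIter k c.src) with hD
  set E : PBond P k → ℝ := fun c => M c - ℓ * (ℓ ^ P.d)⁻¹ * FS c with hE
  set W : PBond P k → ℝ := fun c => ℓ ^ 2 * (ℓ ^ P.d)⁻¹ * FS c with hW
  set G : ℝ := ∑ b : PBond P 0, ∑ ν : Fin P.d, (B ⟨b.src.shift ν, b.dir⟩ - B b) ^ 2 with hG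
  have hG0 : 0 ≤ G := Finset.sum_nonneg fun _ _ => Finset.sum_nonneg fun _ _ => sq_nonneg _
  -- (a) the full gradient energy is the curl energy (`∂^*B = 0`)
  have hGcurl : G = ∑ p : Plaq P 0, curl 1 B p ^ 2 := by
    rw [hG, sum_grad_sq_eq_curl_add_diverg B]
    simp [hdiv]
  -- (c) N5 (iii): the line mean minus the face mean costs longitudinal gradients only
  have hN5 : ∑ c : PBond P k, E c ^ 2 ≤ ℓ ^ 2 * (ℓ ^ P.d)⁻¹ * G := by
    have h3 := sum_sq_lineMean_sub_faceMean_le h B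
    have eM : ∀ c : PBond P k, (((P.L : ℝ) ^ k) ^ P.d * (P.L : ℝ) ^ k)⁻¹ *
        ∑ x ∈ univ.filter (fun x : Site P 0 => Site.proj k k x = c.src), ∑ t ∈ range (P.L ^ k),
          B ⟨(fun z : Site P 0 => z.shift c.dir)^[t] x, c.dir⟩ = M c := fun c => (bondAvgIter_eq_lineBlockAvg_real hk B c).symm
    simp only [eM] at h3
    refine h3.trans (mul_le_mul_of_nonneg_left ?_ (by positivity))
    -- longitudinal ≤ all
    rw [hG, sum_pbond]
    rw [show (∑ x : Site P 0, ∑ μ : Fin P.d, ∑ ν : Fin P.d, (B ⟨(PBond.mk x μ).src.shift ν, (PBond.mk x μ).dir⟩ - B ⟨x, μ⟩) ^ 2)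
        = ∑ μ : Fin P.d, ∑ x : Site P 0, ∑ ν : Fin P.d, (B ⟨x.shift ν, μ⟩ - B ⟨x, μ⟩) ^ 2 from Finset.sum_comm]
    refine Finset.sum_le_sum fun μ _ => Finset.sum_le_sum fun x _ => ?_
    exact Finset.single_le_sum (f := fun ν : Fin P.d => (B ⟨x.shift ν, μ⟩ - B ⟨x, μ⟩) ^ 2) (fun ν _ => sq_nonneg _) (Finset.mem_univ μ)
  -- (d) orthogonality of the coarse gradient to the face flux (N5 (ii))
  have hOrth : ∑ c : PBond P k, D c * FS c = 0 :=
    sum_faceLayer_mul_coarseGrad_eq_zero h one_ne_zero hdiv (fun y => lam (embIter k y))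
  -- (e) the constraint, rearranged: `D + W = r − ℓE`
  have hDW : ∀ c, D c + W c = r c - ℓ * E c := fun c => by
    have hc := hC1 c
    simp only [hD, hW, hE, hM] at hc ⊢
    linear_combination hc
  have h2sq : ∀ a b : ℝ, (a - b) ^ 2 ≤ 2 * a ^ 2 + 2 * b ^ 2 := fun a b => by nlinarith [sq_nonneg (a + b)]
  -- (f) Pythagoras: `Σ D² ≤ Σ (r − ℓE)² ≤ 2Σr² + 2ℓ²ΣE²`
  have hP1 : ∑ c : PBond P k, D c ^ 2 ≤ 2 * ∑ c : PBond P k, r c ^ 2 + 2 * (ℓ ^ 2 * ∑ c : PBond P k, E c ^ 2) := by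
    have e : ∑ c : PBond P k, (r c - ℓ * E c) ^ 2
        = ∑ c : PBond P k, D c ^ 2 + 2 * (ℓ ^ 2 * (ℓ ^ P.d)⁻¹) * ∑ c : PBond P k, D c * FS c + ∑ c : PBond P k, W c ^ 2 := by
      rw [Finset.mul_sum, ← Finset.sum_add_distrib, ← Finset.sum_add_distrib]
      refine Finset.sum_congr rfl fun c _ => ?_
      rw [← hDW c]
      simp only [hW]
      ring
    have h1 : ∑ c : PBond P k, D c ^ 2 ≤ ∑ c : PBond P k, (r c - ℓ * E c) ^ 2 := by
      rw [e, hOrth, mul_zero, add_zero]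
      exact le_add_of_nonneg_right (Finset.sum_nonneg fun c _ => sq_nonneg _)
    refine h1.trans ?_
    rw [Finset.mul_sum, Finset.mul_sum, Finset.mul_sum, ← Finset.sum_add_distrib]
    exact Finset.sum_le_sum fun c _ => by nlinarith [h2sq (r c) (ℓ * E c)]
  -- bookkeeping at `d = 3`: `ℓ²·ΣE² ≤ ℓ·G`
  rw [hd] at hN5
  have hN5' : ℓ ^ 2 * ∑ c : PBond P k, E c ^ 2 ≤ ℓ * G := by
    have := mul_le_mul_of_nonneg_left hN5 (sq_nonneg ℓ)
    calc ℓ ^ 2 * ∑ c : PBond P k, E c ^ 2 ≤ ℓ ^ 2 * (ℓ ^ 2 * (ℓ ^ 3)⁻¹ * G) := this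
      _ = ℓ * G := by field_simp
  rw [← hGcurl]
  have : ∑ c : PBond P k, D c ^ 2 ≤ 2 * ∑ c : PBond P k, r c ^ 2 + 2 * (ℓ * G) := by linarith [hP1, hN5']
  simpa only [hD, mul_assoc] using this

end RealCore

/-! ## §2 One real reading of the matrix Hodge parts, with LEMMA H displayed -/

section Component

variable {N : ℕ}

/-- ★ **ONE READING `π` OF THE MATRIX HODGE PARTS, WITH LEMMA H DISPLAYED**: for `B = Y − ∂φ` with `∂^*B = 0`, the matrix constraint of N7-A, the centre-harmonic
condition `Δ(Δ(π∘φ)) = 0` off the `k`-centres, and LEMMA H (`hH`: `L^k·Σ_x (Δψ)² ≤ C_H·Σ_c (ψ(c₊) − ψ(c₋))²` for every real `ψ` with `Δ²ψ = 0` off the centres),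
`Σ_x (Δ(π∘φ))(x)² ≤ C_H·(2(L^k)⁻¹·Σ_c π(Λ(c₊) − Λ(c₋))² + 2·Σ_p π((∂Y)(p))²)` (`∂B = ∂Y`).
[cite: Balaban1984PropagatorsI, Prop. 1.1 (1.90) p.33; Balaban1985Variational, Prop. 7 p.299] -/
theorem component_div_bound (hd : P.d = 3) {k : ℕ} (hk : k ≤ P.m + P.K) (π : Matrix (Fin N) (Fin N) ℂ →ₗ[ℝ] ℝ)
    (Y : PBond P 0 → Matrix (Fin N) (Fin N) ℂ) (φ : Site P 0 → Matrix (Fin N) (Fin N) ℂ) (Λ : Site P k → Matrix (Fin N) (Fin N) ℂ)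
    (hcoul : diverg 1 (fun e => Y e - grad 1 φ e) = 0)
    (hC1 : ∀ c : PBond P k, (P.L ^ k : ℕ) • bondAvgIter k (fun e => Y e - grad 1 φ e) c + (φ (embIter k c.tgt) - φ (embIter k c.src))
      = Λ c.tgt - Λ c.src)
    {CH : ℝ} (hCH : 0 ≤ CH)
    (hH : ∀ ψ : SiteField P 0 ℝ, (∀ x : Site P 0, x ∉ Set.range (embIter k) → laplace 1 (laplace 1 ψ) x = 0) →
      (P.L : ℝ) ^ k * ∑ x : Site P 0, laplace 1 ψ x ^ 2 ≤ CH * ∑ c : PBond P k, (ψ (embIter k c.tgt) - ψ (embIter k c.src)) ^ 2)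
    (hSH : ∀ x : Site P 0, x ∉ Set.range (embIter k) → laplace 1 (laplace 1 (fun y => π (φ y))) x = 0) :
    ∑ x : Site P 0, laplace 1 (fun y => π (φ y)) x ^ 2
      ≤ CH * (2 * ((P.L : ℝ) ^ k)⁻¹ * ∑ c : PBond P k, π (Λ c.tgt - Λ c.src) ^ 2 + 2 * ∑ p : Plaq P 0, π (curl 1 Y p) ^ 2) := by
  have hL1 : (1 : ℝ) ≤ P.L := by exact_mod_cast P.L_pos
  set ℓ : ℝ := (P.L : ℝ) ^ k with hℓ
  have hℓ0 : 0 < ℓ := by positivity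
  have hdiv : diverg 1 (fun e => π (Y e - grad 1 φ e)) = 0 := by
    funext x
    rw [Pi.zero_apply, ← map_diverg π _ x, congrFun hcoul x, Pi.zero_apply, map_zero]
  have hC1' : ∀ c : PBond P k, (P.L : ℝ) ^ k * bondAvgIter k (fun e => π (Y e - grad 1 φ e)) c
      + ((fun y => π (φ y)) (embIter k c.tgt) - (fun y => π (φ y)) (embIter k c.src)) = π (Λ c.tgt - Λ c.src) := by
    intro c
    have hc := congrArg π (hC1 c)
    rw [map_add, map_nsmul, map_bondAvgIter π hk, map_sub, nsmul_eq_mul] at hc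
    push_cast at hc
    exact hc
  have hcore := sum_coarseDiff_sq_le hd hk (fun e => π (Y e - grad 1 φ e)) (fun y => π (φ y))
    (fun c => π (Λ c.tgt - Λ c.src)) hdiv hC1'
  have hcurl : ∀ p : Plaq P 0, curl 1 (fun e => π (Y e - grad 1 φ e)) p = π (curl 1 Y p) := fun p => by
    rw [← map_curl π _ p]
    exact congrArg π (curl_gaugeShift 1 1 φ Y p)
  simp only [hcurl] at hcore
  -- LEMMA H on the reading `π ∘ φ`
  have hHπ := hH (fun y => π (φ y)) hSH
  -- `ℓ·Σ(Δ(πφ))² ≤ CH·ΣD² ≤ CH·(2Σr² + 2ℓ·CURL)`; divide by `ℓ`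
  have hR0 : 0 ≤ ∑ c : PBond P k, π (Λ c.tgt - Λ c.src) ^ 2 := Finset.sum_nonneg fun _ _ => sq_nonneg _
  have hK0 : 0 ≤ ∑ p : Plaq P 0, π (curl 1 Y p) ^ 2 := Finset.sum_nonneg fun _ _ => sq_nonneg _
  have hS0 : 0 ≤ ∑ x : Site P 0, laplace 1 (fun y => π (φ y)) x ^ 2 := Finset.sum_nonneg fun _ _ => sq_nonneg _
  have h1 : ℓ * ∑ x : Site P 0, laplace 1 (fun y => π (φ y)) x ^ 2
      ≤ CH * (2 * ∑ c : PBond P k, π (Λ c.tgt - Λ c.src) ^ 2 + 2 * ℓ * ∑ p : Plaq P 0, π (curl 1 Y p) ^ 2) :=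
    hHπ.trans (mul_le_mul_of_nonneg_left hcore hCH)
  have h2 : CH * (2 * ∑ c : PBond P k, π (Λ c.tgt - Λ c.src) ^ 2 + 2 * ℓ * ∑ p : Plaq P 0, π (curl 1 Y p) ^ 2)
      = ℓ * (CH * (2 * ℓ⁻¹ * ∑ c : PBond P k, π (Λ c.tgt - Λ c.src) ^ 2 + 2 * ∑ p : Plaq P 0, π (curl 1 Y p) ^ 2)) := by
    field_simp
  rw [h2] at h1
  exact le_of_mul_le_mul_left h1 hℓ0

end Component

/-! ## §3 The flat ζ-row on `S_H ∩ fibre`, LEMMA H displayed -/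

section Assembly

variable {N : ℕ}

set_option maxHeartbeats 400000 in
/-- ★★★ **THE FLAT ζ-ROW ON `S_H ∩ fibre` (LEMMA H displayed; `d = 3`)**: for an `M_N(ℂ)`-valued bond field `Y` on the finest torus with `Q^{(k)}Y = 0` (`Q^{(k)}` any
composite of the linearised average) and `Δ(∂^*Y) = 0` off the `k`-centres `embIter k y`, and LEMMA H with constant `C_H ≥ 0` (`hH`; ★routeR-w3's
`Prop7CentreHarmonicDivFlat.lemmaH_flat` gives `C_H = 3π⁴/4` on the `Tor (fine n M)` carrier),
`Σ_x ‖(∂^*Y)(x)‖²_F ≤ C_H·(2 + 600·N²·L⁴/(√L − 1)²)·Σ_p ‖(∂Y)(p)‖²_F` — uniformly in `k` and in the volume.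
[cite: Balaban1984PropagatorsI, Prop. 1.1 (1.90) p.33, (1.21) p.21; Balaban1985Variational, Prop. 7 p.299, (141)-(143) p.299; Balaban1985BackgroundPropagators, Thm 3.11 p.416] -/
theorem sum_diverg_normSq_le_curl_normSq_of_centreHarmonic (hd : P.d = 3) [NeZero N]
    (Q : (i : ℕ) → (PBond P 0 → Matrix (Fin N) (Fin N) ℂ) → PBond P i → Matrix (Fin N) (Fin N) ℂ)
    (hQ0 : ∀ Y, Q 0 Y = Y)
    (hQs : ∀ (i : ℕ) (Y : PBond P 0 → Matrix (Fin N) (Fin N) ℂ) (c : PBond P (i + 1)), Q (i + 1) Y c = linAvg (Q i Y) c)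
    (Y : PBond P 0 → Matrix (Fin N) (Fin N) ℂ) {k : ℕ} (hk : k ≤ P.m + P.K) (hQY : ∀ c : PBond P k, Q k Y c = 0)
    (hSH : ∀ x : Site P 0, x ∉ Set.range (embIter k) → laplace 1 (diverg 1 Y) x = 0)
    {CH : ℝ} (hCH : 0 ≤ CH)
    (hH : ∀ ψ : SiteField P 0 ℝ, (∀ x : Site P 0, x ∉ Set.range (embIter k) → laplace 1 (laplace 1 ψ) x = 0) →
      (P.L : ℝ) ^ k * ∑ x : Site P 0, laplace 1 ψ x ^ 2 ≤ CH * ∑ c : PBond P k, (ψ (embIter k c.tgt) - ψ (embIter k c.src)) ^ 2) :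
    ∑ x : Site P 0, ∑ a : Fin N, ∑ b' : Fin N, Complex.normSq ((diverg 1 Y x) a b')
      ≤ CH * (2 + 600 * (N : ℝ) ^ 2 * (P.L : ℝ) ^ 4 / (Real.sqrt P.L - 1) ^ 2)
          * ∑ p : Plaq P 0, ∑ a : Fin N, ∑ b' : Fin N, Complex.normSq ((curl 1 Y p) a b') := by
  classical
  -- the matrix Coulomb gauge and `Δφ = ∂^*Y`
  obtain ⟨φ, hcoul⟩ := Prop7MatrixHodgeSplit.exists_matrixCoulombGauge Y
  have hlapφ : laplace 1 φ = diverg 1 Y := by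
    have h := hcoul
    rw [diverg_sub, diverg_grad] at h
    funext x
    have hx := congrFun h x
    simp only [Pi.zero_apply] at hx
    exact (sub_eq_zero.mp hx).symm
  have hYB : ∀ b : PBond P 0, Y b = (fun e => Y e - grad 1 φ e) b + (φ b.tgt - φ b.src) := fun b => by
    simp only [grad, one_smul, sub_add_cancel]
  -- the constraint on the Hodge parts, with the `(H¹)^*`-bounded `Λ`
  obtain ⟨Λ, hC1, hC2⟩ := Prop7PinnedConstraintSplit.exists_constraint_on_hodge_parts_bound hd Q hQ0 hQs Y
    (fun e => Y e - grad 1 φ e) φ hYB hk hQY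
  -- letters
  have hL1 : (1 : ℝ) < P.L := by exact_mod_cast P.hL.2
  set ℓ : ℝ := (P.L : ℝ) ^ k with hℓ
  have hℓ0 : 0 < ℓ := by positivity
  set CURL : ℝ := ∑ p : Plaq P 0, ∑ a : Fin N, ∑ b' : Fin N, Complex.normSq ((curl 1 Y p) a b') with hCURL
  set R : ℝ := ∑ c : PBond P k, ∑ a : Fin N, ∑ b' : Fin N, Complex.normSq ((Λ c.tgt - Λ c.src) a b') with hR
  set c₂ : ℝ := (((P.d + 2) * P.L : ℕ) : ℝ) ^ 2 * N * (P.L : ℝ) ^ 2 * ((P.L : ℝ) ^ k / (Real.sqrt P.L - 1) ^ 2) with hc₂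
  have hc₂0 : 0 ≤ c₂ := by positivity
  -- the centre-harmonic condition entrywise
  have hSHre : ∀ a b' : Fin N, ∀ x : Site P 0, x ∉ Set.range (embIter k) →
      laplace 1 (laplace 1 (fun y => ((φ y) a b').re)) x = 0 := by
    intro a b' x hx
    have h0 := hSH x hx
    rw [← hlapφ] at h0
    have h1 : ((laplace 1 (laplace 1 φ) x) a b').re = 0 := by rw [h0]; simp
    rw [Prop7MatrixHodgeSplit.re_laplace_apply] at h1
    have e : (fun y : Site P 0 => ((laplace 1 φ y) a b').re) = laplace 1 (fun y => ((φ y) a b').re) :=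
      funext fun y => Prop7MatrixHodgeSplit.re_laplace_apply φ y a b'
    rw [e] at h1
    exact h1
  have hSHim : ∀ a b' : Fin N, ∀ x : Site P 0, x ∉ Set.range (embIter k) →
      laplace 1 (laplace 1 (fun y => ((φ y) a b').im)) x = 0 := by
    intro a b' x hx
    have h0 := hSH x hx
    rw [← hlapφ] at h0
    have h1 : ((laplace 1 (laplace 1 φ) x) a b').im = 0 := by rw [h0]; simp
    rw [Prop7MatrixHodgeSplit.im_laplace_apply] at h1
    have e : (fun y : Site P 0 => ((laplace 1 φ y) a b').im) = laplace 1 (fun y => ((φ y) a b').im) :=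
      funext fun y => Prop7MatrixHodgeSplit.im_laplace_apply φ y a b'
    rw [e] at h1
    exact h1
  -- per entry: §2 for the real and the imaginary reading, summed
  have hent : ∀ a b' : Fin N,
      ∑ x : Site P 0, Complex.normSq ((diverg 1 Y x) a b')
        ≤ CH * (2 * ℓ⁻¹ * ∑ c : PBond P k, Complex.normSq ((Λ c.tgt - Λ c.src) a b') + 2 * ∑ p : Plaq P 0, Complex.normSq ((curl 1 Y p) a b')) := by
    intro a b'
    obtain ⟨πr, hπr⟩ := exists_reEntry (N := N) a b'
    obtain ⟨πi, hπi⟩ := exists_imEntry (N := N) a b'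
    have hr := component_div_bound hd hk πr Y φ Λ hcoul hC1 hCH hH (by simpa only [hπr] using hSHre a b')
    have hi := component_div_bound hd hk πi Y φ Λ hcoul hC1 hCH hH (by simpa only [hπi] using hSHim a b')
    simp only [hπr] at hr
    simp only [hπi] at hi
    -- `(∂^*Y)(x)_{ab'} = (Δφ)(x)_{ab'}` entrywise
    have eD : ∀ x : Site P 0, Complex.normSq ((diverg 1 Y x) a b')
        = laplace 1 (fun y => ((φ y) a b').re) x ^ 2 + laplace 1 (fun y => ((φ y) a b').im) x ^ 2 := by
      intro x
      rw [← hlapφ, Prop7MatrixHodgeSplit.normSq_eq_re_sq_add_im_sq, Prop7MatrixHodgeSplit.re_laplace_apply,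
        Prop7MatrixHodgeSplit.im_laplace_apply]
    simp only [eD, Prop7MatrixHodgeSplit.normSq_eq_re_sq_add_im_sq, Finset.sum_add_distrib, Matrix.sub_apply, Complex.sub_re, Complex.sub_im]
    simp only [Matrix.sub_apply, Complex.sub_re, Complex.sub_im] at hr hi
    nlinarith [hr, hi]
  have hsum : ∑ x : Site P 0, ∑ a : Fin N, ∑ b' : Fin N, Complex.normSq ((diverg 1 Y x) a b') ≤ CH * (2 * ℓ⁻¹ * R + 2 * CURL) := by
    rw [sum_comm₃ (fun (x : Site P 0) (a b' : Fin N) => Complex.normSq ((diverg 1 Y x) a b')), hR, hCURL,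
      sum_comm₃ (fun (c : PBond P k) (a b' : Fin N) => Complex.normSq ((Λ c.tgt - Λ c.src) a b')),
      sum_comm₃ (fun (p : Plaq P 0) (a b' : Fin N) => Complex.normSq ((curl 1 Y p) a b'))]
    have step : ∑ a : Fin N, ∑ b' : Fin N, ∑ x : Site P 0, Complex.normSq ((diverg 1 Y x) a b')
        ≤ ∑ a : Fin N, ∑ b' : Fin N, CH * (2 * ℓ⁻¹ * ∑ c : PBond P k, Complex.normSq ((Λ c.tgt - Λ c.src) a b')
          + 2 * ∑ p : Plaq P 0, Complex.normSq ((curl 1 Y p) a b')) :=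
      Finset.sum_le_sum fun a _ => Finset.sum_le_sum fun b' _ => hent a b'
    refine step.trans (le_of_eq ?_)
    simp only [mul_add, Finset.sum_add_distrib, Finset.mul_sum]
  -- `R ≤ 12·N·c₂·CURL` (N7 Step 6b verbatim)
  have hcurlB : ∀ p : Plaq P 0, curl 1 (fun e => Y e - grad 1 φ e) p = curl 1 Y p := fun p => curl_gaugeShift 1 1 φ Y p
  have hRle : R ≤ 12 * N * c₂ * CURL := by
    set Eb : Site P k → ℝ := fun y => ∑ μ : Fin P.d, ∑ ν : Fin P.d, ∑ x ∈ univ.filter (fun x : Site P 0 => Site.proj k k x = y),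
        (if Site.proj k k (x.shift ν) = y then
          ‖(Y ⟨x.shift ν, μ⟩ - grad 1 φ ⟨x.shift ν, μ⟩) - (Y ⟨x, μ⟩ - grad 1 φ ⟨x, μ⟩)‖ ^ 2 else 0) with hEb
    have hC2' : ∀ y : Site P k, ‖Λ y‖ ^ 2 ≤ c₂ * Eb y := fun y => by simpa only [hEb] using hC2 y
    have h1 : ∀ c : PBond P k, ∑ a : Fin N, ∑ b' : Fin N, Complex.normSq ((Λ c.tgt - Λ c.src) a b')
        ≤ 2 * N * c₂ * (Eb c.tgt + Eb c.src) := by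
      intro c
      have ht := (sum_normSq_le_mul_opNorm_sq (Λ c.tgt)).trans (mul_le_mul_of_nonneg_left (hC2' c.tgt) (Nat.cast_nonneg N))
      have hs := (sum_normSq_le_mul_opNorm_sq (Λ c.src)).trans (mul_le_mul_of_nonneg_left (hC2' c.src) (Nat.cast_nonneg N))
      have hsub := sum_normSq_sub_le (Λ c.tgt) (Λ c.src)
      have e1 : (↑N * (c₂ * Eb c.tgt) : ℝ) = N * c₂ * Eb c.tgt := by ring
      have e2 : (↑N * (c₂ * Eb c.src) : ℝ) = N * c₂ * Eb c.src := by ring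
      linarith [ht, hs, hsub]
    have h2 := Finset.sum_le_sum fun c (_ : c ∈ (Finset.univ : Finset (PBond P k))) => h1 c
    rw [← Finset.mul_sum, sum_pbond_tgt_add_src Eb, ← hR] at h2
    have h3 := sum_blockEnergy_le (P := P) (k := k) (fun e => Y e - grad 1 φ e)
    rw [sum_grad_normSq_eq_curl_normSq _ hcoul] at h3
    simp only [hcurlB] at h3
    have h3' : ∑ y : Site P k, Eb y ≤ CURL := by simpa only [hEb, hCURL] using h3
    have hd3 : (P.d : ℝ) = 3 := by exact_mod_cast hd
    rw [hd3] at h2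
    have h4 := mul_le_mul_of_nonneg_left h3' (by positivity : (0 : ℝ) ≤ 2 * N * c₂ * (2 * 3))
    linarith [h2, h4]
  -- the constant
  have h5L : (((P.d + 2) * P.L : ℕ) : ℝ) = 5 * P.L := by rw [hd]; push_cast; ring
  have hCURL0 : 0 ≤ CURL := Finset.sum_nonneg fun _ _ => Finset.sum_nonneg fun _ _ => Finset.sum_nonneg fun _ _ => Complex.normSq_nonneg _
  have hsq : 0 < (Real.sqrt P.L - 1) ^ 2 := by
    have : 1 < Real.sqrt (P.L : ℝ) := by
      rw [show (1 : ℝ) = Real.sqrt 1 from Real.sqrt_one.symm]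
      exact Real.sqrt_lt_sqrt zero_le_one hL1
    nlinarith
  have hfin : 2 * ℓ⁻¹ * R ≤ 600 * (N : ℝ) ^ 2 * (P.L : ℝ) ^ 4 / (Real.sqrt P.L - 1) ^ 2 * CURL := by
    have h := mul_le_mul_of_nonneg_left hRle (by positivity : (0 : ℝ) ≤ 2 * ℓ⁻¹)
    refine h.trans (le_of_eq ?_)
    rw [hc₂, h5L]
    field_simp
    ring
  calc ∑ x : Site P 0, ∑ a : Fin N, ∑ b' : Fin N, Complex.normSq ((diverg 1 Y x) a b')
      ≤ CH * (2 * ℓ⁻¹ * R + 2 * CURL) := hsum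
    _ ≤ CH * (600 * (N : ℝ) ^ 2 * (P.L : ℝ) ^ 4 / (Real.sqrt P.L - 1) ^ 2 * CURL + 2 * CURL) :=
        mul_le_mul_of_nonneg_left (by linarith [hfin]) hCH
    _ = CH * (2 + 600 * (N : ℝ) ^ 2 * (P.L : ℝ) ^ 4 / (Real.sqrt P.L - 1) ^ 2) * CURL := by ring

/-- ★ **THE T³ INSTANCE** (run `K` of a T³ family, comparison height `n`, `k = K − n`, `d = 3`): for `Q^{(K−n)}Y = 0`, `Δ(∂^*Y) = 0` off the `(K−n)`-centres and
LEMMA H with constant `C_H`, `Σ_x ‖(∂^*Y)(x)‖²_F ≤ C_H·(2 + 600·N²·L⁴/(√L − 1)²)·Σ_p ‖(∂Y)(p)‖²_F`, uniformly in `m`, `n`, `K`.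
[cite: Balaban1984PropagatorsI, Prop. 1.1 (1.90) p.33; Balaban1985Variational, Prop. 7 p.299] -/
theorem sum_diverg_normSq_le_curl_normSq_of_centreHarmonic_T3 (F : T3ContinuumYM3Torus.T3Family) (K n : ℕ) [NeZero N]
    (Q : (i : ℕ) → (PBond (F.P K) 0 → Matrix (Fin N) (Fin N) ℂ) → PBond (F.P K) i → Matrix (Fin N) (Fin N) ℂ)
    (hQ0 : ∀ Y, Q 0 Y = Y)
    (hQs : ∀ (i : ℕ) (Y : PBond (F.P K) 0 → Matrix (Fin N) (Fin N) ℂ) (c : PBond (F.P K) (i + 1)), Q (i + 1) Y c = linAvg (Q i Y) c)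
    (Y : PBond (F.P K) 0 → Matrix (Fin N) (Fin N) ℂ) (hQY : ∀ c : PBond (F.P K) (K - n), Q (K - n) Y c = 0)
    (hSH : ∀ x : Site (F.P K) 0, x ∉ Set.range (embIter (K - n)) → laplace 1 (diverg 1 Y) x = 0)
    {CH : ℝ} (hCH : 0 ≤ CH)
    (hH : ∀ ψ : SiteField (F.P K) 0 ℝ, (∀ x : Site (F.P K) 0, x ∉ Set.range (embIter (K - n)) → laplace 1 (laplace 1 ψ) x = 0) →
      (F.L : ℝ) ^ (K - n) * ∑ x : Site (F.P K) 0, laplace 1 ψ x ^ 2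
        ≤ CH * ∑ c : PBond (F.P K) (K - n), (ψ (embIter (K - n) c.tgt) - ψ (embIter (K - n) c.src)) ^ 2) :
    ∑ x : Site (F.P K) 0, ∑ a : Fin N, ∑ b' : Fin N, Complex.normSq ((diverg 1 Y x) a b')
      ≤ CH * (2 + 600 * (N : ℝ) ^ 2 * (F.L : ℝ) ^ 4 / (Real.sqrt F.L - 1) ^ 2)
          * ∑ p : Plaq (F.P K) 0, ∑ a : Fin N, ∑ b' : Fin N, Complex.normSq ((curl 1 Y p) a b') := by
  have hk : K - n ≤ (F.P K).m + (F.P K).K := by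
    have := F.hm
    show K - n ≤ F.m + K
    omega
  exact sum_diverg_normSq_le_curl_normSq_of_centreHarmonic (P := F.P K) (T3ContinuumYM3Torus.T3Family.P_d F K) Q hQ0 hQs Y hk hQY hSH hCH hH

end Assembly

end Summit.QuantumFields.YangMills.Theorems.Prop7CentreHarmonicDivEngine

end
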